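import Mathlib
import Literature.NumberTheory.LFunctions.Zhang2022.TypedSection17
import Literature.NumberTheory.LFunctions.Zhang2022.Section17Swap
import Literature.NumberTheory.LFunctions.Zhang2022.SkeletonChiTwist
import Literature.NumberTheory.LFunctions.Zhang2022.ToolkitSmoothEulerMajorant
import Literature.NumberTheory.LFunctions.Zhang2022.Section14Eq148Leg1
import HarnessLib

/-!
# Zhang (2022) §17.u023 in the χ-twisted reading of record (RT16-int-1; rows G-L4t6-1/1a):
# `Σ'_{(m₁,𝔮)=1} b(l₁m₁)χ(l₁m₁)κ̄₂(m₁)/m₁ = 𝔢₁χ(l₁)τ₂(l₁) + O(α𝓛·τ₂(l₁))` from Lemma 15.1 (χ) + the swap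

Topic `Literature/NumberTheory/LFunctions/Zhang2022` (Landau–Siegel audit tree; verdict-neutral).
Y. Zhang, *Discrete mean estimates and the Landau–Siegel zero*, arXiv:2211.02515v1 (2022)
[Zhang2022LandauSiegel] — **an unrefereed manuscript under adjudication**; nothing here asserts or
denies its Theorems 1–2. §17 p. 98 (tex L4830–L4837; DAG `Z22:§17.u023`): "Hence, by Lemma 15.1 (see
(15.)), `Σ_{(m₁,𝔮)=1} b(l₁m₁)κ̄₂(m₁)/m₁ = 𝔢₁χ(l₁)τ₂(l₁) + O`" [bare]. READING OF RECORD (WP16-PLAN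
§1.6 RT16-int-1; cell rows G-L4t1-1 «consumers twist at the edge», G-L4t6-1/1a, RULING 13d; the literal
χ-free node `Typed.Section17.Step17_u023` is the refuted N-19 and is never a target): the coefficient of
`B(s,ψ)` is `b(n)χ(n)` ((15.1)), so the display reads, for `1 ≤ l₁ < D⁴`,
`Σ'_{(m₁,𝔮)=1} b(l₁m₁)χ(l₁m₁)κ̄₂(m₁)/m₁ = 𝔢₁χ(l₁)τ₂(l₁) + O(α𝓛·τ₂(l₁))` (INLINE statement; no new
`def … : Prop`). PROVED here as `step17_u023Chi_of_lemma151Chi` FROM Lemma 15.1 in the χ-reading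
(`Skeleton.Lemma151Chi c′`, `j = 1`, `n₁ = l₁ ∈ 𝒩(𝔮)`, `l₁ < D⁴ ≤ T`) taken as a HYPOTHESIS BY NAME
(App. B cone; WP15 discharges it) and the tree's kernel-checked weight swap `Skeleton.swap17_bound`
(`Σ |b(l₁m)|·|χ(m)κ̄₂(m) − ϱ*₁(m)|/m ≤ C𝓛⁻⁸τ₂(l₁)`, and `𝓛⁻⁸ = α𝓛/π`), with `χ(l₁m) = χ(l₁)χ(m)` and
`χ(m)² ∈ {0,1}` (`norm_chi_mul_sub_chi_sq_mul_le`); the series is a finite sum by the support of `b`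
((15.2), `Skeleton.bcoef_eq_zero_of_le`; `tsum_u023Chi_eq_sum`).

Theorems only (no definitions, no named facts); axioms standard. WHAT THIS IS NOT: a proof of Lemma 15.1
or of the literal u023; any claim about Theorems 1–2 of the source or about Landau–Siegel zeros; nothing
here bears on the cell's verdict on (8.24).

## References

* Y. Zhang, arXiv:2211.02515v1 (2022), §17 p. 98 (u023); §15 (15.1)–(15.2), Lemma 15.1 p. 86;
  App. B (B.1) p. 106. [cite: Zhang2022LandauSiegel, §17 u023 p.98]
-/

noncomputable section

open Complex Real Finset
open Literature.NumberTheory.LFunctions.Zhang2022.Skeleton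
open Literature.NumberTheory.LFunctions.Zhang2022.Typed.Section17

namespace Literature.NumberTheory.LFunctions.Zhang2022.Phi3Eval

/-! ## §1. u023 in the χ-reading, from Lemma 15.1 (χ) and the weight swap -/

section U023

variable {D : ℕ} (χ : DirichletCharacter ℂ D)

/-- For a real `χ`: `|χ(m)κ − χ(m)²ρ| ≤ |χ(m)κ − ρ|` (`χ(m) ∈ {0, ±1}`). [cite: Zhang2022LandauSiegel, §17 u023 p.98] -/
theorem norm_chi_mul_sub_chi_sq_mul_le (hχ : χ.IsQuadratic) (m : ℕ) (κ ρ : ℂ) :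
    ‖χ (m : ZMod D) * κ - χ (m : ZMod D) ^ 2 * ρ‖ ≤ ‖χ (m : ZMod D) * κ - ρ‖ := by
  rcases hχ (m : ZMod D) with h | h | h <;> rw [h]
  · simp
  · simp
  · rw [show (-1 : ℂ) ^ 2 * ρ = ρ by ring]

/-- `1 ≤ l₁ < D⁴` ⇒ `l₁ ∈ 𝒩(𝔮)` (`𝔮 = ∏_{q<D⁴} q`: every prime factor of `l₁` is `≤ l₁ < D⁴`).
[cite: Zhang2022LandauSiegel, §15 p.86] -/
theorem mem_nset_frakq_of_lt {l₁ : ℕ} (h1 : 1 ≤ l₁) (h4 : l₁ < D ^ 4) : l₁ ∈ nset (frakq D) := by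
  rw [SmoothEulerMajorant.mem_nset_frakq_iff, Nat.mem_smoothNumbers]
  refine ⟨by omega, fun p hp => ?_⟩
  exact lt_of_le_of_lt (Nat.le_of_mem_primeFactorsList hp) h4

/-- The series of u021/u023 (χ-reading) is a finite sum: `b(l₁m₁) = 0` once `m₁ ≥ ⌈P⌉` (support (15.2),
`b(n) = 0` for `n ≥ PT⁻²`; `l₁ ≥ 1`). [cite: Zhang2022LandauSiegel, §15 (15.2) p.79] -/
theorem tsum_u023Chi_eq_sum (c' : ℝ) (hℓ : 3 ≤ ell D) {l₁ : ℕ} (h1 : 1 ≤ l₁) :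
    (∑' m₁ : ℕ, if Nat.Coprime m₁ (frakq D) then
        bcoef D (l₁ * m₁) * χ ((l₁ * m₁ : ℕ) : ZMod D) * kappa2bar c' D m₁ / (m₁ : ℂ) else 0) =
      ∑ m₁ ∈ (Finset.Ico 1 ⌈bigP D⌉₊).filter (fun m => Nat.Coprime m (frakq D)),
        bcoef D (l₁ * m₁) * χ ((l₁ * m₁ : ℕ) : ZMod D) * kappa2bar c' D m₁ / (m₁ : ℂ) := by
  classical
  have hvan : ∀ m ∉ Finset.Ico 1 ⌈bigP D⌉₊, (if Nat.Coprime m (frakq D) then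
      bcoef D (l₁ * m) * χ ((l₁ * m : ℕ) : ZMod D) * kappa2bar c' D m / (m : ℂ) else 0) = 0 := by
    intro m hm
    rw [Finset.mem_Ico, not_and_or, not_le, not_lt] at hm
    rcases hm with hm | hm
    · have hm0 : m = 0 := by omega
      subst hm0
      simp
    · -- `m ≥ ⌈P⌉ ⇒ l₁m ≥ P ≥ PT⁻² ⇒ b(l₁m) = 0`
      have hT1 : 1 ≤ bigT D := Real.one_le_exp (by positivity)
      have hP0 : 0 ≤ bigP D := (Real.exp_pos _).le
      have hb : bcoef D (l₁ * m) = 0 := by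
        refine bcoef_eq_zero_of_le hℓ ?_
        calc bigP D / bigT D ^ 2 ≤ bigP D := by
              rw [div_le_iff₀ (by positivity)]
              nlinarith [one_le_pow₀ (M₀ := ℝ) hT1 (n := 2)]
          _ ≤ ⌈bigP D⌉₊ := Nat.le_ceil _
          _ ≤ m := by exact_mod_cast hm
          _ ≤ ((l₁ * m : ℕ) : ℝ) := by exact_mod_cast Nat.le_mul_of_pos_left m h1
      simp [hb]
  rw [tsum_eq_sum hvan, Finset.sum_filter]

/-- **§17.u023 in the χ-reading of record** (rows G-L4t6-1/1a, RULING 13d; RT16-int-1): from Lemma 15.1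
in the χ-reading (`Skeleton.Lemma151Chi c′`, hypothesis BY NAME) and the kernel-checked weight swap
`Skeleton.swap17_bound`: there is `C` with, for all large `D` under (A) and every `1 ≤ l₁ < D⁴`,
`‖Σ'_{(m₁,𝔮)=1} b(l₁m₁)χ(l₁m₁)κ̄₂(m₁)/m₁ − 𝔢₁χ(l₁)τ₂(l₁)‖ ≤ C·α𝓛·τ₂(l₁)` (the printed right side of
u023 with the error the lemma gives; `𝓛⁻⁸ = α𝓛/π`). [cite: Zhang2022LandauSiegel, §17 u023 p.98] -/
theorem step17_u023Chi_of_lemma151Chi (c' : ℝ) (h151 : Lemma151Chi c') :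
    ∃ C : ℝ, ForAllLarge fun D _ χ => AssumptionA D χ → ∀ l₁ : ℕ, 1 ≤ l₁ → l₁ < D ^ 4 →
      ‖(∑' m₁ : ℕ, if Nat.Coprime m₁ (frakq D) then
            bcoef D (l₁ * m₁) * χ ((l₁ * m₁ : ℕ) : ZMod D) * kappa2bar c' D m₁ / (m₁ : ℂ) else 0) -
          frake 1 * χ (l₁ : ZMod D) * (l₁.divisors.card : ℂ)‖ ≤
        C * alpha D * ell D * l₁.divisors.card := by
  obtain ⟨C₁, h₁⟩ := h151
  obtain ⟨C₂, h₂⟩ := swap17_bound c'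
  obtain ⟨D₁, hD₁⟩ := Typed.Sec14.pow_four_le_bigT
  obtain ⟨D₂, hD₂⟩ := exists_nat_forall_le_ell 3
  refine ⟨C₁ + |C₂| / Real.pi, ?_⟩
  obtain ⟨D₀, hall⟩ := h₁.and h₂
  refine ⟨max D₀ (max D₁ D₂), fun D _ χ hD hq hp hA l₁ hl1 hl4 => ?_⟩
  have hD0 : D₀ ≤ D := le_trans (le_max_left _ _) hD
  have hT := hD₁ D (le_trans (le_trans (le_max_left _ _) (le_max_right _ _)) hD)
  have hℓ3 := hD₂ D (le_trans (le_trans (le_max_right _ _) (le_max_right _ _)) hD)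
  obtain ⟨e151, esw⟩ := hall D χ hD0 hq hp
  have hℓ0 : 0 < ell D := by linarith
  have hπ := Real.pi_pos
  have hα0 : 0 < alpha D := alpha_pos' hℓ0
  have hα : alpha D = Real.pi / ell D ^ 9 := by rw [alpha, bigP, Real.log_exp]
  have hℓ8 : (ell D ^ 8)⁻¹ = alpha D * ell D / Real.pi := by
    rw [hα]; field_simp
  -- Lemma 15.1 (χ) at `j = 1`, `n₁ = l₁`
  have hmem : l₁ ∈ nset (frakq D) := mem_nset_frakq_of_lt hl1 hl4
  have hlT : (l₁ : ℝ) < bigT D := lt_of_lt_of_le (by exact_mod_cast hl4) hT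
  have e1 := e151 hA 1 (by simp) l₁ hmem hlT
  have e2 := esw hA l₁ hl1
  set S := (Finset.Ico 1 ⌈bigP D⌉₊).filter (fun m => Nat.Coprime m (frakq D)) with hS
  rw [tsum_u023Chi_eq_sum χ c' hℓ3 hl1]
  -- split: (ours − Lemma 15.1's sum) + (Lemma 15.1's sum − main)
  set A : ℂ := ∑ m ∈ S, bcoef D (l₁ * m) * χ ((l₁ * m : ℕ) : ZMod D) * kappa2bar c' D m / (m : ℂ)
    with hAdef
  set B : ℂ := ∑ m ∈ S, χ ((l₁ * m : ℕ) : ZMod D) * bcoef D (l₁ * m) * χ (m : ZMod D) *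
    varrhoStar c' χ 1 m / (m : ℂ) with hBdef
  have hAB : A - B = χ (l₁ : ZMod D) * ∑ m ∈ S, bcoef D (l₁ * m) *
      (χ (m : ZMod D) * kappa2bar c' D m - χ (m : ZMod D) ^ 2 * varrhoStar c' χ 1 m) / (m : ℂ) := by
    rw [hAdef, hBdef, ← Finset.sum_sub_distrib, Finset.mul_sum]
    refine Finset.sum_congr rfl fun m _ => ?_
    push_cast
    rw [map_mul]
    ring
  have hAB' : ‖A - B‖ ≤ C₂ * (ell D ^ 8)⁻¹ * l₁.divisors.card := by
    rw [hAB, norm_mul]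
    calc ‖χ (l₁ : ZMod D)‖ * ‖∑ m ∈ S, bcoef D (l₁ * m) *
          (χ (m : ZMod D) * kappa2bar c' D m - χ (m : ZMod D) ^ 2 * varrhoStar c' χ 1 m) / (m : ℂ)‖
        ≤ 1 * ∑ m ∈ S, ‖bcoef D (l₁ * m)‖ *
            ‖χ (m : ZMod D) * kappa2bar c' D m - varrhoStar c' χ 1 m‖ / (m : ℝ) := by
          refine mul_le_mul (χ.norm_le_one _) ((norm_sum_le _ _).trans (Finset.sum_le_sum
            fun m _ => ?_)) (norm_nonneg _) zero_le_one
          rw [norm_div, norm_mul, Complex.norm_natCast]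
          exact div_le_div_of_nonneg_right (mul_le_mul_of_nonneg_left
            (norm_chi_mul_sub_chi_sq_mul_le χ hq m _ _) (norm_nonneg _)) (Nat.cast_nonneg m)
      _ ≤ C₂ * (ell D ^ 8)⁻¹ * l₁.divisors.card := by rw [one_mul]; exact e2
  have hBmain : ‖B - frake 1 * χ (l₁ : ZMod D) * (l₁.divisors.card : ℂ)‖ ≤
      C₁ * alpha D * ell D * l₁.divisors.card := by
    have e : frake 1 * χ (l₁ : ZMod D) * (l₁.divisors.card : ℂ) =
        χ (l₁ : ZMod D) * (l₁.divisors.card : ℂ) * frake 1 := by ring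
    rw [e]; exact e1
  have hτ0 : (0 : ℝ) ≤ l₁.divisors.card := Nat.cast_nonneg _
  calc ‖A - frake 1 * χ (l₁ : ZMod D) * (l₁.divisors.card : ℂ)‖
      = ‖(A - B) + (B - frake 1 * χ (l₁ : ZMod D) * (l₁.divisors.card : ℂ))‖ := by ring_nf
    _ ≤ ‖A - B‖ + ‖B - frake 1 * χ (l₁ : ZMod D) * (l₁.divisors.card : ℂ)‖ := norm_add_le _ _
    _ ≤ C₂ * (ell D ^ 8)⁻¹ * l₁.divisors.card + C₁ * alpha D * ell D * l₁.divisors.card :=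
        add_le_add hAB' hBmain
    _ ≤ |C₂| * (ell D ^ 8)⁻¹ * l₁.divisors.card + C₁ * alpha D * ell D * l₁.divisors.card := by
        gcongr; exact le_abs_self _
    _ = (C₁ + |C₂| / Real.pi) * alpha D * ell D * l₁.divisors.card := by
        rw [hℓ8]; field_simp; ring

end U023

end Literature.NumberTheory.LFunctions.Zhang2022.Phi3Eval
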